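import Summits.BirchSwinnertonDyer.Rank1Residual.Additive.RamifiedSevenResidualNonvanishingOfGenus
import Summits.BirchSwinnertonDyer.Rank1Residual.Additive.KatoDescentKMCImpReadingIsogenyClass
import Literature.NumberTheory.EllipticCurves.CyclotomicZpExtension
import Literature.NumberTheory.EllipticCurves.Kato2004.IwasawaCohomologyExistsProofs
import HarnessLib

set_option autoImplicit false

/-!
# `𝒞₇` genus road (crux `EllipticUnitValueSevenOfGZK`, K7r), block (B4): the EXISTENCE conjunct of stub 2★ and the
# stub statement `stub_primitiveAdmissibleMemberSeven` (zp v10a, aea8fabcb2511144) VERBATIM from the genus inputs —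
# (α) an admissible Kato zeta class at the modular-lattice member from ★ + GZK + (E2); (β) 2★ from (α) and block (B3);
# THEOREMS ONLY

Cell bsd-cm, seat bsd-cm-prr-ty1 g28 (literature-prover), row (GENUS-PORT-B) of the scope `SCOPE-GENUS-PORT-F8.md`
(16530c741a99cc96), SUMMON 1c4b9c2558877aeb; frozen proof-memo `MEMO-bsd-cm-genus` v1 (a38f3eedd2c92d58) §10 («NOT the first
conjunct … a different matter»), ideator audit `E3primeAudit-g58.md` / `ExistenceConjunct-g57.md`.  THEOREMS ONLY (no `def`,
no named fact, no instance, no notation, no `sorry`).  Imports: block (B3) (hence (B1b), row A's GENUS-PORT-A files, p765067,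
★'s `ZetaClassOnRankLeOneBranch` with its §6 μ-free pipeline), E56 `KatoDescentKMCImpReadingIsogenyClass` (`X12.ClassCSeven.of_isIsogenous`),
`CyclotomicZpExtension` (the cyclotomic `ℤ₇`-extension and a normalised topological generator, THEOREMS) and
`Kato2004.IwasawaCohomologyExistsProofs` (`nonempty_iwasawaH1Data_holds`, THEOREM).

## What is proved (kernel)

* (α) `exists_isAdmissibleZetaClass_of_classCSeven (hstar) (hGZK)`: at a member `W′ ∈ 𝒞₇`, for every cyclotomic datum
  `(K, hK, γ, hγ, I′)` carrying a μ-FREE value-pinned realised family (`HasMuFreeRealisedZetaFamily W′ 7 K hK I′`, the (E2)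
  input), an ADMISSIBLE class exists — ONE `exact` of ★'s base-level §6 corollary
  `exists_zetaClassPosition_of_rank_le_one.exists_isAdmissibleZetaClass_of_muFree_of_rank_integralH1_le_one` under the
  (Ш-input) path (STATUS 12:19:26Z): `r_an(W′) = 1` (`X12.ClassCSeven`), GZK ⇒ Mordell–Weil rank one AND `Ш(W′)` finite
  (the crux's own antecedent `rank_eq_analyticRank_of_analyticRank_le_one`), `LocPKummer.rank_integralH1_le_one`, and
  `Λ`-FREENESS of `I′.H` by `IwasawaH1Data.moduleFree_of_torsionBy_eq_bot` at `W′(ℚ)[7] = 0`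
  (`KatoMuResidual.torsionBy_eq_bot_of_not_dvd_torsionOrder` + `ValueOfKMCPerrinRiou.not_seven_dvd_torsionOrder`, p765067).
* `existsAdmissibleMemberSeven_of_muFree` — v9's stub 2a′ body VERBATIM from {★, GZK, (E2)-closed}: the cyclotomic datum is
  SUPPLIED by the tree theorems `CyclotomicZp.isCyclotomic_zpExtension`, `CyclotomicZp.exists_isTopGenerator_zpExtension`,
  `Kato2004.nonempty_iwasawaH1Data_holds`.
* (β) `primitiveAdmissibleMemberSeven_of_genus` — the TYPE of zp v10a's `stub_primitiveAdmissibleMemberSeven` (l. 281–289)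
  VERBATIM, from: ★ `Kato2004.exists_zetaClassPosition_of_rank_le_one`, GZK, the three printed facts of row A's (G6)
  (`tsuji1999_thm31_colemanMap`, `ferreroWashington_kubotaLeopoldtSeries_unitCoeff`, `ferreroWashington_stickelbergerSeries_unitCoeff`),
  and the pen's three closed forms — K1ᵘ (row A's ORIENTED form), K2ᶜ (block (B3)'s `hK2c`), (E2) (`hE2` below: «every
  `W ∈ 𝒞₇` is `ℚ`-isogenous to a globally minimal `W′` — the modular-lattice member, `T₇W′ ≃ V_{ℤ₇}(f_D)(1)` — carrying
  `HasMuFreeRealisedZetaFamily W′ 7 K hK I′` in every cyclotomic pin»; NO print covers it at the additive prime `7`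
  (STATUS (E2-scope) 12:19:26Z), so it is the pen's `stub_muFreeRealisedFamilySeven`).  Conjunct (i) = `(α)` at `W′`,
  conjunct (ii) = block (B3)'s `residualNonvanishingSeven_of_orientedGenus` at `W′ ∈ 𝒞₇` (`X12.ClassCSeven.of_isIsogenous`).

HONEST LABEL: conditional theorems; K1ᵘ, K2ᶜ, (E2) are the pen's research stubs and ★, GZK, Tsuji, FW are named inputs;
nothing about Kato's Conj. 12.10, `X12.CMRamifiedSeven` or BSD is asserted; stmt-BirchSwinnertonDyer-19945 is OPEN; no
summit statement is proved by this seat; BSD is claimed for no curve.  References: K. Kato, Astérisque 295 (2004) Thm. 12.4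
(2)(3), Thm. 12.5 (1)(4) (pp. 221–222), §13.9, §13.14 (pp. 230–234), (15.16.1) (p. 265) [Kato2004Asterisque]; C. Wuthrich,
Doc. Math. 19 (2014) §3 [Wuthrich2014Integrality] (semistable only — why (E2) is a stub).
-/

noncomputable section

open scoped Classical NumberField

open WeierstrassCurve Literature.NumberTheory.EllipticCurves
open Literature.NumberTheory.EllipticCurves.Rank1Residual
open Literature.NumberTheory.EllipticCurves.IwasawaAlgebra
open Literature.NumberTheory.EllipticCurves.Kato2004
open Literature.NumberTheory.ComplexMultiplication.EllipticUnits
open Summit.BirchSwinnertonDyer.Rank1Residual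
open Summit.BirchSwinnertonDyer.Rank1Residual.Additive

namespace Summit.BirchSwinnertonDyer.Rank1Residual.Additive.GenusSeven

/-! ## §1 (α) An admissible class at a `𝒞₇` member carrying a μ-free realised family -/

/-- **(α) EXISTENCE OF AN ADMISSIBLE KATO ZETA CLASS at a `𝒞₇` member from ★, GZK and a μ-free realised family** (the (E2)
input at this pin): `rank_{ℤ₇} H¹(ℤ[1/7], T₇W′) ≤ 1` from Mordell–Weil rank one and `Ш(W′)` finite (GZK at `r_an = 1`),
`I′.H` is `Λ`-free since `W′(ℚ)[7] = 0` on `𝒞₇`, and ★'s §6 pipeline divides `7^k` out of the uniform position.  ONE `exact`.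
CONDITIONAL on the displayed hypotheses; nothing asserted.
[cite: Kato2004Asterisque, Thm. 12.5 (1) (p. 221), Thm. 12.4 (3) (p. 221), §13.14 (p. 234)] -/
theorem exists_isAdmissibleZetaClass_of_classCSeven (hstar : exists_zetaClassPosition_of_rank_le_one)
    (hGZK : rank_eq_analyticRank_of_analyticRank_le_one)
    (W' : WeierstrassCurve ℚ) [W'.IsElliptic] [W'.IsGloballyMinimal] [Fact (Nat.Prime 7)] (hC' : X12.ClassCSeven W')
    [ContinuousSMul ℤ_[7] (W'.tateModule 7)] {K : ZpExtension ℚ 7} (hK : K.IsCyclotomic)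
    {γ : Field.absoluteGaloisGroup ℚ} (hγ : K.IsTopGenerator γ) (I : IwasawaH1Data W' 7 K γ)
    (hR : HasMuFreeRealisedZetaFamily W' 7 K hK I) :
    ∃ z₀ : I.H, IsAdmissibleZetaClass W' 7 K hK I z₀ := by
  have hr : W'.analyticRank = 1 := hC'.2.2.1
  have hrank : W'.mordellWeilRank = 1 := by rw [(hGZK W' hr.le).1, hr]
  haveI : Finite W'.sha := (hGZK W' hr.le).2
  have hsha : Finite (AddCommGroup.primaryComponent W'.sha 7) := inferInstance
  have hR1 := LocPKummer.rank_integralH1_le_one W' 7 K hrank hsha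
  haveI : Module.Free (IwasawaAlgebra 7) I.H :=
    I.moduleFree_of_torsionBy_eq_bot hK hγ
      (KatoMuResidual.torsionBy_eq_bot_of_not_dvd_torsionOrder W' 7
        (Summit.BirchSwinnertonDyer.BirchSwinnertonDyer.Theorems.RamifiedSevenEllipticUnits.ValueOfKMCPerrinRiou.not_seven_dvd_torsionOrder
          W' hC'))
  exact hstar.exists_isAdmissibleZetaClass_of_muFree_of_rank_integralH1_le_one hK hγ (by decide) I hR1 hR

/-! ## §2 v9's stub 2a′ (an admissible class at an isogenous member) from ★, GZK and (E2) -/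

/-- **v9's 2a′ `stub_existsAdmissibleMemberSeven` body VERBATIM from {★, GZK, (E2)-closed}**: take the member `W′` of `hE2`,
the cyclotomic `ℤ₇`-extension of `ℚ` with a normalised topological generator (`CyclotomicZpExtension.lean`, theorems), a pin
`I′` (`nonempty_iwasawaH1Data_holds`, theorem), and (α).  CONDITIONAL; nothing asserted.
[cite: Kato2004Asterisque, Thm. 12.5 (1)(4) (pp. 221–222), §13.14 (p. 234)] [cite: Washington1997, §13.1] -/
theorem existsAdmissibleMemberSeven_of_muFree (hstar : exists_zetaClassPosition_of_rank_le_one)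
    (hGZK : rank_eq_analyticRank_of_analyticRank_le_one)
    (hE2 : ∀ (W : WeierstrassCurve ℚ) [W.IsElliptic] [W.IsGloballyMinimal] [Fact (Nat.Prime 7)], X12.ClassCSeven W →
      ∃ (W' : WeierstrassCurve ℚ) (_ : W'.IsElliptic) (_ : W'.IsGloballyMinimal), IsIsogenous W W' ∧
        letI : ContinuousSMul ℤ_[7] (W'.tateModule 7) := TateModule.continuousSMul_padicInt
        ∀ (K : ZpExtension ℚ 7) (hK : K.IsCyclotomic) (γ : Field.absoluteGaloisGroup ℚ) (_ : K.IsTopGenerator γ)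
          (I : IwasawaH1Data W' 7 K γ), Kato2004.HasMuFreeRealisedZetaFamily W' 7 K hK I) :
    ∀ (W : WeierstrassCurve ℚ) [W.IsElliptic] [W.IsGloballyMinimal] [Fact (Nat.Prime 7)], X12.ClassCSeven W →
      ∃ (W' : WeierstrassCurve ℚ) (_ : W'.IsElliptic) (_ : W'.IsGloballyMinimal), IsIsogenous W W' ∧
        letI : ContinuousSMul ℤ_[7] (W'.tateModule 7) := TateModule.continuousSMul_padicInt
        ∃ (K : ZpExtension ℚ 7) (hK : K.IsCyclotomic) (γ : Field.absoluteGaloisGroup ℚ) (_ : K.IsTopGenerator γ)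
          (I : IwasawaH1Data W' 7 K γ) (z₀ : I.H), Kato2004.IsAdmissibleZetaClass W' 7 K hK I z₀ := by
  intro W _ _ _ hC
  obtain ⟨W', hE', hM', hiso, hfam⟩ := hE2 W hC
  haveI := hE'
  haveI := hM'
  have hC' : X12.ClassCSeven W' := hC.of_isIsogenous hiso
  refine ⟨W', hE', hM', hiso, ?_⟩
  haveI : ContinuousSMul ℤ_[7] (W'.tateModule 7) := TateModule.continuousSMul_padicInt
  have hK : (CyclotomicZp.zpExtension 7).IsCyclotomic := CyclotomicZp.isCyclotomic_zpExtension 7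
  obtain ⟨γ, hγ, -⟩ := CyclotomicZp.exists_isTopGenerator_zpExtension 7
  obtain ⟨I⟩ := nonempty_iwasawaH1Data_holds W' 7 (CyclotomicZp.zpExtension 7) γ hK hγ
  obtain ⟨z₀, hz₀⟩ :=
    exists_isAdmissibleZetaClass_of_classCSeven hstar hGZK W' hC' hK hγ I (hfam _ hK γ hγ I)
  exact ⟨CyclotomicZp.zpExtension 7, hK, γ, hγ, I, z₀, hz₀⟩

/-! ## §3 (β) Stub 2★ `stub_primitiveAdmissibleMemberSeven` VERBATIM from the genus inputs -/

/-- **(β) STUB 2★ OF zp v10a — `stub_primitiveAdmissibleMemberSeven` (l. 281–289, aea8fabcb2511144) — ITS TYPE VERBATIM, FROM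
THE GENUS INPUTS**: ★ (`exists_zetaClassPosition_of_rank_le_one`), GZK, the three printed facts of (G6) (Tsuji's Coleman map,
Ferrero–Washington ×2), and the pen's three closed forms K1ᵘ (`hK1u`, row A's oriented form), K2ᶜ (`hK2c`, block (B3)) and
(E2) (`hE2`).  The witness member is (E2)'s `W′`; conjunct (i) is (α), conjunct (ii) is block (B3)'s
`residualNonvanishingSeven_of_orientedGenus` at `W′ ∈ 𝒞₇`.  The pen derives the stub by `exact primitiveAdmissibleMemberSeven_of_genus …`.
CONDITIONAL; nothing asserted; 19945 stays OPEN.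
[cite: Kato2004Asterisque, Thm. 12.5 (1)(4) (pp. 221–222), Conj. 12.10 (p. 224), (15.16.1) (p. 265)] [cite: Tsuji1999, Thm 3.1 (i) (p. 6)]
[cite: FerreroWashington1979, main theorem] -/
theorem primitiveAdmissibleMemberSeven_of_genus (hstar : exists_zetaClassPosition_of_rank_le_one)
    (hGZK : rank_eq_analyticRank_of_analyticRank_le_one)
    (h₄ : Literature.NumberTheory.IwasawaTheory.tsuji1999_thm31_colemanMap)
    (h₂ : Literature.NumberTheory.IwasawaTheory.ferreroWashington_kubotaLeopoldtSeries_unitCoeff)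
    (h₂' : Literature.NumberTheory.IwasawaTheory.ferreroWashington_stickelbergerSeries_unitCoeff)
    (hK1u : ∀ (F : GenusFrame) (θu : ∀ n : ℕ, globalUnitsOf (F.layer n)), IsNormedEllipticUnitFamily F θu →
      ∃ d : OrientedGenusDatum F θu, OrientedGenusFactorisationShape d)
    (hK2c : ∀ (W : WeierstrassCurve ℚ) [W.IsElliptic] [W.IsGloballyMinimal] [Fact (Nat.Prime 7)], X12.ClassCSeven W →
      letI : ContinuousSMul ℤ_[7] (W.tateModule 7) := TateModule.continuousSMul_padicInt
      ∀ (K : ZpExtension ℚ 7) (hK : K.IsCyclotomic) (γ : Field.absoluteGaloisGroup ℚ) (_ : K.IsTopGenerator γ)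
        (I : IwasawaH1Data W 7 K γ),
        ∃ (F : GenusFrame) (θu : ∀ n : ℕ, globalUnitsOf (F.layer n)), IsNormedEllipticUnitFamily F θu ∧
          ∀ d : GenusDatum F θu, ∃ Φ : KatoGenusFrame W K hK I d, ResidueIsGenusUnitClassShape Φ)
    (hE2 : ∀ (W : WeierstrassCurve ℚ) [W.IsElliptic] [W.IsGloballyMinimal] [Fact (Nat.Prime 7)], X12.ClassCSeven W →
      ∃ (W' : WeierstrassCurve ℚ) (_ : W'.IsElliptic) (_ : W'.IsGloballyMinimal), IsIsogenous W W' ∧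
        letI : ContinuousSMul ℤ_[7] (W'.tateModule 7) := TateModule.continuousSMul_padicInt
        ∀ (K : ZpExtension ℚ 7) (hK : K.IsCyclotomic) (γ : Field.absoluteGaloisGroup ℚ) (_ : K.IsTopGenerator γ)
          (I : IwasawaH1Data W' 7 K γ), Kato2004.HasMuFreeRealisedZetaFamily W' 7 K hK I) :
    ∀ (W : WeierstrassCurve ℚ) [W.IsElliptic] [W.IsGloballyMinimal] [Fact (Nat.Prime 7)], X12.ClassCSeven W →
      ∃ (W' : WeierstrassCurve ℚ) (_ : W'.IsElliptic) (_ : W'.IsGloballyMinimal), IsIsogenous W W' ∧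
        letI : ContinuousSMul ℤ_[7] (W'.tateModule 7) := TateModule.continuousSMul_padicInt
        (∃ (K : ZpExtension ℚ 7) (hK : K.IsCyclotomic) (γ : Field.absoluteGaloisGroup ℚ) (_ : K.IsTopGenerator γ)
          (I : IwasawaH1Data W' 7 K γ) (z₀ : I.H), Kato2004.IsAdmissibleZetaClass W' 7 K hK I z₀) ∧
        (∀ (K : ZpExtension ℚ 7) (hK : K.IsCyclotomic) (γ : Field.absoluteGaloisGroup ℚ) (_ : K.IsTopGenerator γ)
          (I : IwasawaH1Data W' 7 K γ) (z₀ : I.H), Kato2004.IsAdmissibleZetaClass W' 7 K hK I z₀ →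
          z₀ ∉ (IwasawaAlgebra.augIdealP 7 • (⊤ : Submodule (IwasawaAlgebra 7) I.H))) := by
  intro W _ _ _ hC
  obtain ⟨W', hE', hM', hiso, hfam⟩ := hE2 W hC
  haveI := hE'
  haveI := hM'
  have hC' : X12.ClassCSeven W' := hC.of_isIsogenous hiso
  refine ⟨W', hE', hM', hiso, ?_, residualNonvanishingSeven_of_orientedGenus h₄ h₂ h₂' hK1u hK2c W' hC'⟩
  haveI : ContinuousSMul ℤ_[7] (W'.tateModule 7) := TateModule.continuousSMul_padicInt
  have hK : (CyclotomicZp.zpExtension 7).IsCyclotomic := CyclotomicZp.isCyclotomic_zpExtension 7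
  obtain ⟨γ, hγ, -⟩ := CyclotomicZp.exists_isTopGenerator_zpExtension 7
  obtain ⟨I⟩ := nonempty_iwasawaH1Data_holds W' 7 (CyclotomicZp.zpExtension 7) γ hK hγ
  obtain ⟨z₀, hz₀⟩ :=
    exists_isAdmissibleZetaClass_of_classCSeven hstar hGZK W' hC' hK hγ I (hfam _ hK γ hγ I)
  exact ⟨CyclotomicZp.zpExtension 7, hK, γ, hγ, I, z₀, hz₀⟩

end Summit.BirchSwinnertonDyer.Rank1Residual.Additive.GenusSeven

end
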